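import Literature.MathematicalPhysics.QuantumFieldTheory.Balaban1983to89.B9Thm313WholeDir
import Literature.MathematicalPhysics.QuantumFieldTheory.Balaban1983to89.B9Thm313WholeL2GPZ

/-!
# `Balaban1983to89.B9Thm313WholeDirL2Z` — [B9] Theorem 3.13 (p. 426), the MIXED direction-pair block-L² member of 𝔊 with the COARSE-SIDE block-L²
# letters RE-WEIGHTED (Z-twin of the §3 of `B9Thm313WholeDir`; R1-cls extended to the (3.46) line, sequel of `B9Thm313WholeL2GZ ∕ L2GPZ`)

T. Bałaban, *Propagators for lattice gauge theories in a background field*, Commun. Math. Phys. **99** (1985) 389–434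
[`Balaban1985BackgroundPropagators`, "B9"]; [4] = T. Bałaban, *Propagators and renormalization transformations for lattice
gauge theories. II*, Commun. Math. Phys. **96** (1984) 223–250 [`Balaban1984PropagatorsII`].  statement-level skeleton of published
theorems with citation tags; proofs where landed; nothing here is a claim about the Yang–Mills mass gap.

THE POINT.  `Letters313L2MZ … vZ hvZ U` (`Letters313L2M` with `dGQsd` re-weighted by the free `vZ`), `letters313L2MZ_mono`, the pair-family packagings
★ `GG_l2bd_family3Z ∕ GG_l2bd_family5Z` of `B9Thm313WholeL2GPZ.GG_l2bd_leftZ ∕ rightZ`, and ★ `GG_l2bd_mixed_of_lettersZ`, ★ `GG_l2bd_mixedFamily_of_lettersZ` over `Letters313L2PZ ∕ Letters313L2MZ` — SAME conclusions and constants; proofs verbatim but for the Z-side weights.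
`Thm33G0L2M`, `Letters313DM ∕ IM`, the sup cores of `B9Thm313WholeDir` are untouched (the sup cores have their Z-twins in `B9Thm313WholeDirZ`).
`vZ ≡ 1` recovers the flat statements.

HONEST SCOPE.  Nothing of print is asserted: every analytic input is a HYPOTHESIS of printed ∕ md shape; kernel-checked bookkeeping.  NOT a node discharge,
NOT summit progress; one finite lattice at a time; nothing continuum, nothing about the mass gap.  Cell `pub-ymgap` (HUMAN RULING D-0062), Track A node
N06 [B9], N06-ASSIGNMENT v1 row 21 (bundle F7), seat `pub-ymgap-dag-n06-l` (g14), 2026-08-27.  NEW file; nothing landed is modified.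
-/

namespace Literature.MathematicalPhysics.QuantumFieldTheory.Balaban1983to89.B9Thm313WholeDirL2Z

open Literature.MathematicalPhysics.QuantumFieldTheory.Balaban1983to89
open Finset B6RandomWalk B6RandomWalkHom B9Thm34Ext B9Thm37GlueCor36 B11SectG B9SectDSup B9Thm37AllNorms
open B9Thm37AllNormsInstances B9FromB6 B9SectBStepWhole B9Thm312Whole B9Thm312WholeLeaf B9Thm312WholeLeft B9Thm313Whole B9Thm313WholeLeft
open B9Thm37Glue B9SectDL2Decay B9RWSums343Holder B9Ineq347 B9Thm312WholeClasses B9Thm312WholeL2 B9Thm312WholeBlocksRel B9Thm312WholeBlocksNbr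
open B9Thm312WholeHolder B9Thm312WholeHHolder B9Thm313WholeHolder B9Thm313WholeL2G B9Thm313WholeL2GP B9RWSums346SecondDiff B9Thm312WholeDir B9Thm313WholeDir
open B9Thm313WholeL2GZ B9Thm313WholeL2GPZ

noncomputable section

section OneMember

variable {g : B9.Geometry} {B : B9.Backgrounds} {X Y Z W PX PY P : Type}
variable [Fintype X] [Fintype Y] [Fintype Z] [Fintype W] [Fintype PX] [Fintype PY] [Fintype P] [Fintype g.Site]
variable {R₀ : ℝ} {H₀ : Prop}

/-! ## §1 The direction-indexed block-L² letters, coarse side re-weighted (printed shape; nothing asserted) -/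

/-- (**Z-FORM**: `B9Thm313WholeDir.Letters313L2M` with `dGQsd ν` — ∇_{U,ν}G₀Q\* out of the coarse block-L² class — re-weighted by the free `vZ` of
`B9Thm313WholeL2GZ.Letters313L2Z`; `dGDvd`, `rgdDd` verbatim) **THE BLOCK-L² LETTERS OF THE REDUCTION, PER DIRECTION** — the direction twins of `B9Thm313WholeL2G.Letters313L2.dGDv ∕ dGQs ∕ rgdDs`
(there for the bundled ∇_U, ∇\*_U), in the convention of (3.46) with the scale powers split as p. 398 allows: `dGDvd ν` — ∇_{U,ν}G₀Dv (W → X, factor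
1); `dGQsd ν` — ∇_{U,ν}G₀Q\* (Z → X, factor L^{j′}η); `rgdDd μ` — RDv\*G₁∇\*_{U,μ} = RG′Dv\*∇\*_{U,μ} (X → W, factor 1; (3.152), Theorem 3.1 for G′ and
(3.49) for R).  NOTHING ASSERTED: these are the instance's. [cite: Balaban1985BackgroundPropagators, Thm 3.13 p.426 + (3.152)–(3.153) p.426 + (3.46) p.398 + (3.39) p.397 + p.398 (remark after (3.47)); Balaban1984PropagatorsII, (2.26) p.228] -/
structure Letters313L2MZ (𝔬 : Ops g B X Y Z W) (Dd Dds : B.Cfg → P → Module.End ℝ (X → ℝ)) (R₀ : ℝ) (H₀ : Prop) (B₄ δ : ℝ)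
    (vZ : g.Site → ℝ) (hvZ : ∀ y, 0 < vZ y) (U : B.Cfg) : Prop where
  dGDvd : ∀ ν : P, BlockBd (g := toB6 g R₀ H₀) 𝔬.blkW 𝔬.blk (Dd U ν ∘ₗ 𝔬.G0 U ∘ₗ 𝔬.Dv U)
    (fun (y y' : g.Site) => B₄ * Real.exp (-(δ * g.dist y y')))
  dGQsd : ∀ ν : P, BlockBd (g := toB6 g R₀ H₀) 𝔬.blkZ 𝔬.blk (Dd U ν ∘ₗ 𝔬.G0 U ∘ₗ 𝔬.Qstar U)
    (fun (y y' : g.Site) => B₄ * (vZ y' * g.len y') * Real.exp (-(δ * g.dist y y')))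
  rgdDd : ∀ μ : P, BlockBd (g := toB6 g R₀ H₀) 𝔬.blk 𝔬.blkW (𝔬.R U ∘ₗ 𝔬.Dvstar U ∘ₗ 𝔬.G1 U ∘ₗ Dds U μ)
    (fun (y y' : g.Site) => B₄ * Real.exp (-(δ * g.dist y y')))

omit [Fintype Y] [Fintype PX] [Fintype PY] [Fintype P] in
/-- the direction-indexed L² letters at a slower rate (e^{−δd} ≦ e^{−δ′d} for δ′ ≦ δ, d ≧ 0) (the twin of `letters313L2P_mono`).
[cite: Balaban1985BackgroundPropagators, (3.46) p.398 (bookkeeping)] -/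
theorem letters313L2MZ_mono {𝔬 : Ops g B X Y Z W} {Dd Dds : B.Cfg → P → Module.End ℝ (X → ℝ)} {B₄ δ δ' : ℝ} {U : B.Cfg}
    (hG : GeoOK g) (hB₄ : 0 ≤ B₄) (hδ : δ' ≤ δ) {vZ : g.Site → ℝ} {hvZ : ∀ y, 0 < vZ y} (h : Letters313L2MZ 𝔬 Dd Dds R₀ H₀ B₄ δ vZ hvZ U) :
    Letters313L2MZ 𝔬 Dd Dds R₀ H₀ B₄ δ' vZ hvZ U := by
  have hexp : ∀ y y' : g.Site, Real.exp (-(δ * g.dist y y')) ≤ Real.exp (-(δ' * g.dist y y')) := fun y y' =>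
    Real.exp_le_exp.mpr (neg_le_neg (mul_le_mul_of_nonneg_right hδ (hG.dnn y y')))
  have hl : ∀ y : g.Site, 0 ≤ g.len y := hG.lenle
  exact
    { dGDvd := fun ν => (h.dGDvd ν).mono fun y y' => mul_le_mul_of_nonneg_left (hexp y y') hB₄
      dGQsd := fun ν => (h.dGQsd ν).mono fun y y' =>
        mul_le_mul_of_nonneg_left (hexp y y') (mul_nonneg hB₄ (mul_nonneg (hvZ y').le (hl y')))
      rgdDd := fun μ => (h.rgdDd μ).mono fun y y' => mul_le_mul_of_nonneg_left (hexp y y') hB₄ }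

/-! ## §2 The pair-family block-L² lines (3.46)₃, (3.46)₅ and the mixed member of 𝔊 over the re-weighted letters -/

/-- ★ (**Z-TWIN** over `Letters313L2PZ`, coarse block-L² classes re-weighted by `vZ`) **(3.46)₃ FOR 𝔊 AS THE PACKAGED PAIR FAMILY ∇_{U,ν}∇_{U,μ}𝔊** — one model X → X × (P × P) with block map `blk ∘ Prod.fst`, block bound
√|P × P|·`constG46 (constKp B₂ B₄ θ c) c`·Λ·e^{−(ρ−αρ₀)d(y,y′)}: `GG_l2bd_left` for every pair from Theorem 3.3's pair-indexed L² bounds for G₀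
(`Thm33G0L2P.l3 q`) and the pair letters (`Letters313L2P.ddGDv q`, `ddGQs q`), then `blockBd_familyOp`.
[cite: Balaban1985BackgroundPropagators, Thm 3.13 p.426 + (3.153) p.426 + (3.46) p.398 + (3.39) p.397; Balaban1984PropagatorsII, Lemma 2.1 (2.60)–(2.61) p.234] -/
theorem GG_l2bd_family3Z (hG : GeoOK g) {𝔬 : Ops g B X Y Z W} {Dd Dds : B.Cfg → P → Module.End ℝ (X → ℝ)} {U : B.Cfg}
    {B₂ B₄ θ δ ρ ρ₀ α Λ σ c : ℝ} (hrow : RowSum (toB6 g R₀ H₀) σ c) (hB₂ : 0 ≤ B₂) (hB₄ : 0 ≤ B₄) (hθ : 0 ≤ θ) (hρ : 0 ≤ ρ)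
    (hσ : 0 ≤ σ) (hρδ : ρ + 5 * σ ≤ δ) (hΛ : 0 ≤ Λ) (hST : ScaleTransfer g ρ₀ α Λ (fun y => g.len y ^ (1 : ℝ)))
    (hL : Thm33G0L2P 𝔬 Dd Dds R₀ H₀ B₂ δ U)
    (hT : BlockBd (g := toB6 g R₀ H₀) 𝔬.blk 𝔬.blk (𝔬.Tpi U + 𝔬.T2 U)
      (fun (y y' : g.Site) => θ * (g.len y)⁻¹ * (g.len y')⁻¹ * Real.exp (-(δ * g.dist y y'))))
    {vZ : g.Site → ℝ} {hvZ : ∀ y, 0 < vZ y} (hLt : Letters313L2PZ 𝔬 Dd Dds R₀ H₀ B₄ δ vZ hvZ U) (hI : Identities 𝔬 U)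
    (hq : B₂ * θ * c * c < 1) :
    BlockBd (g := toB6 g R₀ H₀) 𝔬.blk (𝔬.blk ∘ Prod.fst) (familyOp (fun q : P × P => (Dd U q.1 ∘ₗ Dd U q.2) ∘ₗ 𝔬.GG U))
      (fun (y y' : g.Site) => Real.sqrt (Fintype.card (P × P)) * (constG46 (constKp B₂ B₄ θ c) c * Λ *
        Real.exp (-((ρ - α * ρ₀) * g.dist y y')))) := by
  have hc : 0 ≤ c ∨ IsEmpty g.Site := by
    by_cases hne : Nonempty g.Site
    · exact Or.inl (hrow.nonneg hne.some)
    · exact Or.inr (not_nonempty_iff.mp hne)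
  rcases hc with hc | hemp
  swap
  · intro y' μ hμ y
    exact (hemp.false y).elim
  have hS0 : 0 ≤ B₂ + B₄ := add_nonneg hB₂ hB₄
  obtain ⟨hKp0, -⟩ := constP_nonneg_le hθ hc hq hS0 hS0 hS0 le_rfl le_rfl le_rfl
  have hKG0 : 0 ≤ constG46 (constKp B₂ B₄ θ c) c := constG46_nonneg hKp0 hc
  exact blockBd_familyOp (R := R₀) (H := H₀) 𝔬.blk 𝔬.blk
    (fun a b => mul_nonneg (mul_nonneg hKG0 hΛ) (Real.exp_nonneg _))
    fun q => GG_l2bd_leftZ hG hrow hB₂ hB₄ hθ hρ hσ hρδ hST (Thm33G0L2P.toLap hB₂ hG.lenle hL) hT (Letters313L2PZ.toLap hB₄ hG.lenle hLt) (hL.l3 q)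
      (hLt.ddGDv q) (hLt.ddGQs q) hI hq

/-- ★ (**Z-TWIN** over `Letters313L2PZ`, coarse block-L² classes re-weighted by `vZ`) **(3.46)₅ FOR 𝔊 AS THE PACKAGED PAIR FAMILY 𝔊∇\*_{U,ν}∇\*_{U,μ}** — one model X → X × (P × P) with block map `blk ∘ Prod.fst`, block bound
√|P × P|·`constG46 (constKp B₂ B₄ θ c) c`·Λ′·e^{−(ρ−αρ₀)d(y,y′)}: `GG_l2bd_right` for every pair from `Thm33G0L2P.l5 q` and the pair letter
`Letters313L2P.rgdDds q`, then `blockBd_familyOp`.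
[cite: Balaban1985BackgroundPropagators, Thm 3.13 p.426 + (3.153) p.426 + (3.46) p.398 + (3.39) p.397; Balaban1984PropagatorsII, Lemma 2.1 (2.60)–(2.61) p.234] -/
theorem GG_l2bd_family5Z (hG : GeoOK g) {𝔬 : Ops g B X Y Z W} {Dd Dds : B.Cfg → P → Module.End ℝ (X → ℝ)} {U : B.Cfg}
    {B₂ B₄ θ δ ρ ρ₀ α Λ σ c : ℝ} (hrow : RowSum (toB6 g R₀ H₀) σ c) (hB₂ : 0 ≤ B₂) (hB₄ : 0 ≤ B₄) (hθ : 0 ≤ θ) (hρ : 0 ≤ ρ)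
    (hσ : 0 ≤ σ) (hρδ : ρ + 5 * σ ≤ δ) (hΛ : 0 ≤ Λ) (hST : ScaleTransfer g ρ₀ α Λ (fun y => g.len y ^ (-1 : ℝ)))
    (hL : Thm33G0L2P 𝔬 Dd Dds R₀ H₀ B₂ δ U)
    (hT : BlockBd (g := toB6 g R₀ H₀) 𝔬.blk 𝔬.blk (𝔬.Tpi U + 𝔬.T2 U)
      (fun (y y' : g.Site) => θ * (g.len y)⁻¹ * (g.len y')⁻¹ * Real.exp (-(δ * g.dist y y'))))
    {vZ : g.Site → ℝ} {hvZ : ∀ y, 0 < vZ y} (hLt : Letters313L2PZ 𝔬 Dd Dds R₀ H₀ B₄ δ vZ hvZ U) (hI : Identities 𝔬 U)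
    (hq : B₂ * θ * c * c < 1) :
    BlockBd (g := toB6 g R₀ H₀) 𝔬.blk (𝔬.blk ∘ Prod.fst) (familyOp (fun q : P × P => 𝔬.GG U ∘ₗ (Dds U q.1 ∘ₗ Dds U q.2)))
      (fun (y y' : g.Site) => Real.sqrt (Fintype.card (P × P)) * (constG46 (constKp B₂ B₄ θ c) c * Λ *
        Real.exp (-((ρ - α * ρ₀) * g.dist y y')))) := by
  have hc : 0 ≤ c ∨ IsEmpty g.Site := by
    by_cases hne : Nonempty g.Site
    · exact Or.inl (hrow.nonneg hne.some)
    · exact Or.inr (not_nonempty_iff.mp hne)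
  rcases hc with hc | hemp
  swap
  · intro y' μ hμ y
    exact (hemp.false y).elim
  have hS0 : 0 ≤ B₂ + B₄ := add_nonneg hB₂ hB₄
  obtain ⟨hKp0, -⟩ := constP_nonneg_le hθ hc hq hS0 hS0 hS0 le_rfl le_rfl le_rfl
  have hKG0 : 0 ≤ constG46 (constKp B₂ B₄ θ c) c := constG46_nonneg hKp0 hc
  exact blockBd_familyOp (R := R₀) (H := H₀) 𝔬.blk 𝔬.blk
    (fun a b => mul_nonneg (mul_nonneg hKG0 hΛ) (Real.exp_nonneg _))
    fun q => GG_l2bd_rightZ hG hrow hB₂ hB₄ hθ hρ hσ hρδ hST (Thm33G0L2P.toLap hB₂ hG.lenle hL) hT (Letters313L2PZ.toLap hB₄ hG.lenle hLt) (hL.l5 q)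
      (hLt.rgdDds q) hI hq

omit [Fintype P] in
/-- ★ (**Z-TWIN** over `Letters313L2PZ ∕ Letters313L2MZ`, coarse block-L² classes re-weighted by `vZ`; statement and proof otherwise verbatim) **(3.46), THE MIXED MEMBER FOR 𝔊 = 𝔓G₁ PER DIRECTION PAIR, AS A BLOCK-L² BOUND** — ‖1_{Δ(y)}∇_{U,ν}𝔊∇\*_{U,μ}f‖₂ ≦ K·e^{−ρd(y,y′)}‖f‖₂ for
supp f ⊂ Δ(y′): (3.153) with E = ∇_{U,ν}, F = ∇\*_{U,μ} (`E_GG_F_eq`), the G₁-entries ∇_νG₁∇\*_μ, ∇_νG₁Dv, ∇_νG₁Q\*, G₁∇\*_μ by r1's Neumann bookkeeping from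
Theorem 3.3 for G₀ per direction (`Thm33G0L2M.l1d ∕ l2d ∕ l4m` + the letters `gDv ∕ gQs` and `Letters313L2M.dGDvd ∕ dGQsd`) and the step
(`entry_l2w_of_step`), the letters RDv\*G₁∇\*_μ (`rgdDd`), C₁, Q (`Letters313L2P`), composed by `hasMaj_frakG_classes` in the block-L² classes (all
cutting costs 1) with [4] (2.61) as the row sum; provisos ρ + 5σ ≦ δ, B₂θc² < 1; K = `constG46 (constKp B₂ B₄ θ c) c` — the per-pair twin of
`B9Thm313WholeL2G.GG_l2bd_entry4` (there for the bundled ∇_U𝔊∇\*_U on the lattice Y).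
[cite: Balaban1985BackgroundPropagators, Thm 3.13 p.426 + (3.153) p.426 + (3.46) p.398 + (3.39) p.397 + Thm 3.12 p.423; Balaban1984PropagatorsII, Lemma 2.1 (2.61) p.234] -/
theorem GG_l2bd_mixed_of_lettersZ (hG : GeoOK g) {𝔬 : Ops g B X Y Z W} {Dd Dds : B.Cfg → P → Module.End ℝ (X → ℝ)} {U : B.Cfg}
    {B₂ B₄ θ δ ρ σ c : ℝ} (hrow : RowSum (toB6 g R₀ H₀) σ c) (hB₂ : 0 ≤ B₂) (hB₄ : 0 ≤ B₄) (hθ : 0 ≤ θ) (hρ : 0 ≤ ρ)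
    (hσ : 0 ≤ σ) (hρδ : ρ + 5 * σ ≤ δ) (hL : Thm33G0L2M 𝔬 Dd Dds R₀ H₀ B₂ δ U)
    (hT : BlockBd (g := toB6 g R₀ H₀) 𝔬.blk 𝔬.blk (𝔬.Tpi U + 𝔬.T2 U)
      (fun (y y' : g.Site) => θ * (g.len y)⁻¹ * (g.len y')⁻¹ * Real.exp (-(δ * g.dist y y'))))
    {vZ : g.Site → ℝ} {hvZ : ∀ y, 0 < vZ y}
    (hLt : Letters313L2PZ 𝔬 Dd Dds R₀ H₀ B₄ δ vZ hvZ U) (hLM : Letters313L2MZ 𝔬 Dd Dds R₀ H₀ B₄ δ vZ hvZ U) (hI : Identities 𝔬 U)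
    (hq : B₂ * θ * c * c < 1) (ν μ : P) :
    BlockBd (g := toB6 g R₀ H₀) 𝔬.blk 𝔬.blk (Dd U ν ∘ₗ (𝔬.GG U ∘ₗ Dds U μ))
      (fun (y y' : g.Site) => constG46 (constKp B₂ B₄ θ c) c * Real.exp (-(ρ * g.dist y y'))) := by
  -- adapted from `B9Thm313WholeL2G.GG_l2bd_entry4` (∇_U ↦ ∇_{U,ν}, ∇\*_U ↦ ∇\*_{U,μ}, lattice Y ↦ X)
  have hc : 0 ≤ c ∨ IsEmpty g.Site := by
    by_cases hne : Nonempty g.Site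
    · exact Or.inl (hrow.nonneg hne.some)
    · exact Or.inr (not_nonempty_iff.mp hne)
  rcases hc with hc | hemp
  swap
  · intro y' μ' hμ y
    exact (hemp.false y).elim
  have htri : Triangle254 (toB6 g R₀ H₀) := fun a b c => hG.tri a b c
  have hW1 : ∀ y : g.Site, 0 < (fun _ : g.Site => (1 : ℝ)) y := fun _ => one_pos
  have hWl : ∀ y : g.Site, 0 < (fun y : g.Site => g.len y) y := fun y => hG.lenpos y
  have hWi : ∀ y : g.Site, 0 < (fun y : g.Site => (g.len y)⁻¹) y := fun y => inv_pos.mpr (hG.lenpos y)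
  have hWv : ∀ y : g.Site, 0 < (fun y : g.Site => vZ y * g.len y) y := fun y => mul_pos (hvZ y) (hG.lenpos y)
  have hWvi : ∀ y : g.Site, 0 < (fun y : g.Site => (vZ y * g.len y)⁻¹) y := fun y => inv_pos.mpr (mul_pos (hvZ y) (hG.lenpos y))
  have hfix : 𝔬.G1 U = 𝔬.G0 U + 𝔬.G0 U ∘ₗ (𝔬.Tpi U + 𝔬.T2 U) ∘ₗ 𝔬.G1 U := fix_of_inverses hI.invG0' hI.invG1
  have hLap : Thm33G0L2 𝔬 (fun _ => (0 : Module.End ℝ (X → ℝ))) R₀ H₀ B₂ δ U := Thm33G0L2P.toLap hB₂ hG.lenle hL.toThm33G0L2P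
  -- constants
  have hS0 : 0 ≤ B₂ + B₄ := add_nonneg hB₂ hB₄
  have hS₂ : B₂ ≤ B₂ + B₄ := by linarith
  have hS₄ : B₄ ≤ B₂ + B₄ := by linarith
  obtain ⟨hKp0, -⟩ := constP_nonneg_le hθ hc hq hS0 hS0 hS0 le_rfl le_rfl le_rfl
  obtain ⟨hP₂0, hP₂le⟩ := constP_nonneg_le hθ hc hq hB₂ hB₂ hB₂ hS₂ hS₂ hS₂
  obtain ⟨hP₄0, hP₄le⟩ := constP_nonneg_le hθ hc hq hB₄ hB₂ hB₄ hS₄ hS₂ hS₄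
  have hB₄K : B₄ ≤ constP B₂ θ c (B₂ + B₄) (B₂ + B₄) (B₂ + B₄) := by
    have hq1 : 0 ≤ (1 - B₂ * θ * c * c)⁻¹ := inv_nonneg.mpr (by linarith)
    have h0 : 0 ≤ (B₂ + B₄) * (θ * ((B₂ + B₄) * (1 - B₂ * θ * c * c)⁻¹) * c) * c :=
      mul_nonneg (mul_nonneg hS0 (mul_nonneg (mul_nonneg hθ (mul_nonneg hS0 hq1)) hc)) hc
    unfold constP; linarith
  have hKK0 : 0 ≤ constP B₂ θ c (B₂ + B₄) (B₂ + B₄) (B₂ + B₄) * constP B₂ θ c (B₂ + B₄) (B₂ + B₄) (B₂ + B₄) * c :=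
    mul_nonneg (mul_nonneg hKp0 hKp0) hc
  -- rates
  have hr₁0 : 0 ≤ ρ + 3 * σ := by linarith
  have hr₁δ : ρ + 3 * σ + 2 * σ ≤ δ := by linarith
  have hr₂0 : 0 ≤ ρ + 2 * σ := by linarith
  have hr₂1 : ρ + 2 * σ ≤ ρ + 3 * σ := by linarith
  have hr₂δ' : ρ + 2 * σ + σ ≤ δ := by linarith
  have hr₂δ : ρ + 2 * σ ≤ δ := by linarith
  have hρr₂ : ρ + 2 * σ ≤ ρ + 2 * σ := le_rfl
  -- the G₁-entries ∇_νG₁∇*_μ, ∇_νG₁Dv, ∇_νG₁Q*, G₁∇*_μ by r1's Neumann bookkeeping, at the rate ρ + 3σ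
  have pG := entry_l2w_of_step hG hW1 hW1 (Eop := Dd U ν) (Fop := Dds U μ) (aS := B₂) (aE := B₂) (aEF := B₂) hrow hB₂ hθ
    hB₂ hB₂ hB₂ hr₁0 hσ hr₁δ hLap hT ((hL.l2d μ).mono fun y y' => le_of_eq (by ring))
    ((hL.l1d ν).mono fun y y' => le_of_eq (by ring)) ((hL.l4m (ν, μ)).mono fun y y' => le_of_eq (by ring)) hfix hq
  have pGD := entry_l2w_of_step hG hW1 hW1 (Eop := Dd U ν) (Fop := 𝔬.Dv U) (aS := B₄) (aE := B₂) (aEF := B₄) hrow hB₂ hθ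
    hB₄ hB₂ hB₄ hr₁0 hσ hr₁δ hLap hT (hLt.gDv.mono fun y y' => le_of_eq (by ring)) ((hL.l1d ν).mono fun y y' => le_of_eq (by ring))
    ((hLM.dGDvd ν).mono fun y y' => le_of_eq (by ring)) hfix hq
  have pGQ := entry_l2w_of_step hG hWv hW1 (Eop := Dd U ν) (Fop := 𝔬.Qstar U) (aS := B₄) (aE := B₂) (aEF := B₄) hrow hB₂ hθ
    hB₄ hB₂ hB₄ hr₁0 hσ hr₁δ hLap hT (hLt.gQs.mono fun y y' => le_of_eq (by ring)) ((hL.l1d ν).mono fun y y' => le_of_eq (by ring))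
    ((hLM.dGQsd ν).mono fun y y' => le_of_eq (by ring)) hfix hq
  have pGDs := entry_l2w_of_step hG hW1 hWi (Eop := LinearMap.id) (Fop := Dds U μ) (aS := B₂) (aE := B₂) (aEF := B₂) hrow
    hB₂ hθ hB₂ hB₂ hB₂ hr₁0 hσ hr₁δ hLap hT ((hL.l2d μ).mono fun y y' => le_of_eq (by ring))
    (by rw [LinearMap.id_comp]; exact hL.l0.mono fun y y' => le_of_eq (by rw [inv_inv]; ring))
    (by rw [LinearMap.id_comp]; exact (hL.l2d μ).mono fun y y' => le_of_eq (by rw [inv_inv]; ring)) hfix hq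
  rw [LinearMap.id_comp] at pGDs
  -- the letters RDv*G₁∇*_μ, C₁, Q in the block-L² classes
  have pRG : HasMaj (l2w (toB6 g R₀ H₀) 𝔬.blk (fun _ : g.Site => (1 : ℝ)) fun y => (hW1 y).le)
      (l2w (toB6 g R₀ H₀) 𝔬.blkW (fun _ : g.Site => (1 : ℝ)) fun y => (hW1 y).le)
      (𝔬.R U ∘ₗ 𝔬.Dvstar U ∘ₗ 𝔬.G1 U ∘ₗ Dds U μ) (fun y y' => B₄ * Real.exp (-(δ * g.dist y y'))) :=
    hasMaj_l2w_of_blockBd_ratio (g := toB6 g R₀ H₀) hW1 hW1 ((hLM.rgdDd μ).mono fun y y' => le_of_eq (by ring))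
  have pC : HasMaj (l2w (toB6 g R₀ H₀) 𝔬.blkZ (fun y : g.Site => (vZ y * g.len y)⁻¹) fun y => (hWvi y).le)
      (l2w (toB6 g R₀ H₀) 𝔬.blkZ (fun y : g.Site => vZ y * g.len y) fun y => (hWv y).le)
      (𝔬.C1 U) (fun y y' => B₄ * Real.exp (-(δ * g.dist y y'))) :=
    hasMaj_l2w_of_blockBd_ratio (g := toB6 g R₀ H₀) hWvi hWv (hLt.c1.mono fun y y' => le_of_eq (by ring))
  have pQ : HasMaj (l2w (toB6 g R₀ H₀) 𝔬.blk (fun y : g.Site => (g.len y)⁻¹) fun y => (hWi y).le)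
      (l2w (toB6 g R₀ H₀) 𝔬.blkZ (fun y : g.Site => (vZ y * g.len y)⁻¹) fun y => (hWvi y).le)
      (𝔬.Q U) (fun y y' => B₄ * Real.exp (-(δ * g.dist y y'))) :=
    hasMaj_l2w_of_blockBd_ratio (g := toB6 g R₀ H₀) hWi hWvi (hLt.q.mono fun y y' => le_of_eq (by rw [inv_inv]; ring))
  -- QG₁∇*_μ at the rate ρ + 2σ
  have pQG := hasMaj_comp_exp htri hG.dnn hrow hB₄ hP₂0 hr₂0 hr₂1 hr₂δ' pQ pGDs
  simp only [l2w_κ, one_mul] at pQG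
  -- everything at (K_p, ρ + 2σ), the composite at K_p²c
  have uG := hasMaj_up hG hP₂0 hP₂le hr₂1 pG
  have uGD := hasMaj_up hG hP₄0 hP₄le hr₂1 pGD
  have uRG := hasMaj_up hG hB₄ hB₄K hr₂δ pRG
  have uGQ := hasMaj_up hG hP₄0 hP₄le hr₂1 pGQ
  have uC := hasMaj_up hG hB₄ hB₄K hr₂δ pC
  have uQG := hasMaj_up hG (mul_nonneg (mul_nonneg hB₄ hP₂0) hc)
    (mul_le_mul_of_nonneg_right (mul_le_mul hB₄K hP₂le hP₂0 hKp0) hc) hρr₂ pQG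
  -- (3.153) composed in the block-L² classes
  have hfr := hasMaj_frakG_classes htri hG.dnn hrow hKp0 hKp0 hKp0 hKp0 hKp0 hKK0 hρ hσ hρr₂ uG uGD uRG uGQ uC uQG
  have hGG := hfr.congr (T' := Dd U ν ∘ₗ (𝔬.GG U ∘ₗ Dds U μ)) fun f => by rw [E_GG_F_eq hI (Dd U ν) (Dds U μ)]
  have hbd := blockBd_of_hasMaj_l2w hGG hW1
  refine hbd.mono fun y y' => le_of_eq ?_
  simp only [l2w_κ, one_mul, toB6_dist, constG46, constKp, mul_one, div_one]

/-- ★ (**Z-TWIN** over `Letters313L2PZ ∕ Letters313L2MZ`) **(3.46)₃ OF THE RECORD (THE MIXED MEMBER) FOR 𝔊 AS THE PACKAGED PAIR FAMILY ∇_{U,ν}𝔊∇\*_{U,μ}** — one model X → X × (P × P) with block map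
`blk ∘ Prod.fst` (n06-k's `familyOp`, the species of the v4 face's `hl3`), block bound √|P × P|·K·e^{−ρd(y,y′)}: `GG_l2bd_mixed_of_letters` for
every pair, then `blockBd_familyOp` ((3.39): *"max_{μ,ν}"* is dominated by the packaged family).
[cite: Balaban1985BackgroundPropagators, Thm 3.13 p.426 + (3.46) p.398 + (3.39) p.397; Balaban1984PropagatorsII, Lemma 2.1 p.234] -/
theorem GG_l2bd_mixedFamily_of_lettersZ (hG : GeoOK g) {𝔬 : Ops g B X Y Z W} {Dd Dds : B.Cfg → P → Module.End ℝ (X → ℝ)} {U : B.Cfg}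
    {B₂ B₄ θ δ ρ σ c : ℝ} (hrow : RowSum (toB6 g R₀ H₀) σ c) (hc : 0 ≤ c) (hB₂ : 0 ≤ B₂) (hB₄ : 0 ≤ B₄) (hθ : 0 ≤ θ) (hρ : 0 ≤ ρ)
    (hσ : 0 ≤ σ) (hρδ : ρ + 5 * σ ≤ δ) (hL : Thm33G0L2M 𝔬 Dd Dds R₀ H₀ B₂ δ U)
    (hT : BlockBd (g := toB6 g R₀ H₀) 𝔬.blk 𝔬.blk (𝔬.Tpi U + 𝔬.T2 U)
      (fun (y y' : g.Site) => θ * (g.len y)⁻¹ * (g.len y')⁻¹ * Real.exp (-(δ * g.dist y y'))))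
    {vZ : g.Site → ℝ} {hvZ : ∀ y, 0 < vZ y}
    (hLt : Letters313L2PZ 𝔬 Dd Dds R₀ H₀ B₄ δ vZ hvZ U) (hLM : Letters313L2MZ 𝔬 Dd Dds R₀ H₀ B₄ δ vZ hvZ U) (hI : Identities 𝔬 U)
    (hq : B₂ * θ * c * c < 1) :
    BlockBd (g := toB6 g R₀ H₀) 𝔬.blk (𝔬.blk ∘ Prod.fst) (familyOp (fun q : P × P => Dd U q.1 ∘ₗ (𝔬.GG U ∘ₗ Dds U q.2)))
      (fun (y y' : g.Site) => Real.sqrt (Fintype.card (P × P)) * (constG46 (constKp B₂ B₄ θ c) c *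
        Real.exp (-(ρ * g.dist y y')))) := by
  have hS0 : 0 ≤ B₂ + B₄ := add_nonneg hB₂ hB₄
  have hKp0 : 0 ≤ constKp B₂ B₄ θ c := (constP_nonneg_le hθ hc hq hS0 hS0 hS0 le_rfl le_rfl le_rfl).1
  have hK0 : 0 ≤ constG46 (constKp B₂ B₄ θ c) c := constG46_nonneg hKp0 hc
  exact blockBd_familyOp (R := R₀) (H := H₀) 𝔬.blk 𝔬.blk
    (fun a b => mul_nonneg hK0 (Real.exp_nonneg _))
    fun q => GG_l2bd_mixed_of_lettersZ hG hrow hB₂ hB₄ hθ hρ hσ hρδ hL hT hLt hLM hI hq q.1 q.2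

end OneMember

end

end Literature.MathematicalPhysics.QuantumFieldTheory.Balaban1983to89.B9Thm313WholeDirL2Z
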